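import Summits.PneNP.PneNP.Theorems.ConvexRankGatesCliqueExtLowerBoundSandwichEffectiveWidth
import Mathlib

/-!
# Wide GRANK gates moving few lines are sandwichable
(partial result towards the stub `stub_grankSandwichable` of the line
`width-threshold-certificate-sparsity`, crux `ConvexRankGates.CliqueExtLowerBound`, stmt-PneNP-10682)

The open stub asks that every WIDE generic-rank threshold gate (dimension `≤ m^c`, any field) fed
with local child pairs be sandwichable on the referee pair. The landed effective-width engine
(`…SandwichEffectiveWidth.sandwichable_of_shortPatterns`) sandwiches every monotone gate all of whose
accepted wire patterns contain an accepted sub-pattern of at most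
`L = ⌊m^{1/16}⌋₊ (log₂ ⌊m^{1/16}⌋₊ + 1)` wires; `grank_smallThreshold_sandwichable` fed it with the
rank threshold (`θ ≤ L`, any dimension). Here a second, incomparable structural sub-class of wide
GRANK gates is settled outright:

* `grank_fewLines_sandwichable` — GRANK gates `[θ ≤ rank_{Frac F[X]} (K₀ + ∑_{vᵢ=1} Xᵢ Kᵢ)]` of ANY
  dimension `d`, ANY threshold `θ` and ANY constant part `K₀ ∈ F^{d×d}`, whose MOVING PART
  `∑ᵢ Xᵢ Kᵢ` is confined to few lines: there are row indices `W` and column indices `W'` with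
  `#W + #W' ≤ L` such that every `Kᵢ` vanishes outside the rows `W` and the columns `W'` (by König's
  theorem: the combined support pattern of the `Kᵢ` has term rank `≤ L`). Examples: rank-completion
  gates "does the fixed matrix `K₀` reach rank `θ` when `≤ L` of its rows/columns are perturbed
  generically by the selected `Kᵢ`", Edmonds matching gates on a fixed bipartite graph plus variable
  edges incident to `≤ L` vertices.

Proof (`grank_local_lines`): by `le_rank_symbolicMatrix_iff` an accepted `v` has a `θ × θ` minor
of the generic matrix `K₀ + ∑ Xᵢ Kᵢ` with a monomial switched on in `v`; in the Leibniz expansion of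
that minor every entry off the lines `W, W'` is a constant, so (`totalDegree_det_le_lines`, rows and
columns of a non-vanishing minor being distinct) the minor has total degree `≤ #W + #W'`, the
monomial involves `≤ #W + #W'` wires, and switching on exactly those wires keeps it: every accepted
pattern has an accepted sub-pattern of `≤ L` wires, and `sandwichable_of_shortPatterns` applies with
no exceptional positives.

What is NOT here: the general wide GRANK gate (moving part of large term rank AND `θ > L`), which
is Valiant-hard (`…GRankCalibration`).

References: J. Edmonds (1967), §5 Thm. 1 [Edmonds1967]; S. Jukna, *Boolean Function Complexity*
(2012), Lemma 9.15 [Jukna2012].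
-/

set_option linter.dupNamespace false

open Literature.Computability.Complexity Filter Finset MvPolynomial

namespace Summit.PneNP.PneNP.Theorems.CliqueExtLowerBound.WidthThreshold.GRankPartial

open Summit.PneNP.PneNP.Theorems.Capture.Negative (card_support_le_totalDegree
  totalDegree_units_smul_le totalDegree_symbolicPolyMatrix_apply_le)
open Summit.PneNP.PneNP.Theorems.CliqueExtLowerBound.WidthThreshold.SandwichEffectiveWidth
  (sandwichable_of_shortPatterns)

/-! ## §1 Minors of a pencil moving few lines have low degree -/

section Lines

variable {F : Type*} [Field F] {n d : ℕ}

/-- **Leibniz bound by lines.** If the entries of a square matrix of polynomials are affine-linear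
and CONSTANT off the rows satisfying `p` and the columns satisfying `q`, then its determinant has
total degree at most `#{a | p a} + #{b | q b}`: every permutation term picks at most that many
non-constant entries. [folklore] -/
theorem totalDegree_det_le_lines {ι : Type*} [Fintype ι] [DecidableEq ι]
    (M : Matrix ι ι (MvPolynomial (Fin n) F)) (p q : ι → Prop) [DecidablePred p] [DecidablePred q]
    (h1 : ∀ a b, (M a b).totalDegree ≤ 1) (h0 : ∀ a b, ¬ p a → ¬ q b → (M a b).totalDegree = 0) :
    M.det.totalDegree ≤ #(univ.filter p) + #(univ.filter q) := by
  rw [Matrix.det_apply]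
  refine (totalDegree_finsetSum _ _).trans (Finset.sup_le fun σ _ => ?_)
  refine (totalDegree_units_smul_le _ _).trans ?_
  refine (totalDegree_finsetProd _ _).trans ?_
  calc ∑ b, (M (σ b) b).totalDegree
      ≤ ∑ b, ((if p (σ b) then 1 else 0) + (if q b then 1 else 0)) :=
        Finset.sum_le_sum fun b _ => by
          by_cases hp : p (σ b)
          · rw [if_pos hp]; exact (h1 _ _).trans (Nat.le_add_right _ _)
          · by_cases hq : q b
            · rw [if_pos hq]; exact (h1 _ _).trans (Nat.le_add_left _ _)
            · rw [h0 _ _ hp hq]; exact Nat.zero_le _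
    _ = ∑ b, (if p (σ b) then 1 else 0) + ∑ b, (if q b then 1 else 0) := Finset.sum_add_distrib
    _ = #(univ.filter p) + #(univ.filter q) := by
        rw [Finset.card_filter, Finset.card_filter]
        congr 1
        exact Equiv.sum_comp σ (fun a => if p a then 1 else 0)

/-- An entry of the generic symbolic matrix `K₀ + ∑ᵢ Xᵢ Kᵢ` at a position where every `Kᵢ`
vanishes is the constant `K₀ a b`. [folklore] -/
theorem totalDegree_symbolicPolyMatrix_apply_eq_zero (K₀ : Matrix (Fin d) (Fin d) F)
    (K : Fin n → Matrix (Fin d) (Fin d) F) {a b : Fin d} (hK : ∀ i, K i a b = 0) :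
    (symbolicPolyMatrix K₀ K a b).totalDegree = 0 := by
  have : symbolicPolyMatrix K₀ K a b = C (K₀ a b) := by
    simp [symbolicPolyMatrix, Matrix.add_apply, Matrix.map_apply, Matrix.sum_apply,
      Matrix.smul_apply, hK]
  rw [this, totalDegree_C]

/-- **GRANK locality by lines (matrix form).** If every `Kᵢ` vanishes outside the rows `W` and the
columns `W'`, and the generic rank of `K₀ + ∑_{vᵢ=1} Xᵢ Kᵢ` is at least `θ` (ANY `d`, `θ`, `K₀`),
then already a sub-selection `t ⊆ {i | vᵢ = 1}` of at most `#W + #W'` wires achieves rank `≥ θ`: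
a non-vanishing `θ`-minor of the generic matrix has a monomial switched on in `v`
(`le_rank_symbolicMatrix_iff`), its rows and columns are distinct, so by
`totalDegree_det_le_lines` it has total degree `≤ #W + #W'`; switch on exactly the variables of
that monomial. [folklore] -/
theorem grank_local_lines (K₀ : Matrix (Fin d) (Fin d) F) (K : Fin n → Matrix (Fin d) (Fin d) F)
    (W W' : Finset (Fin d)) (hK : ∀ i a b, a ∉ W → b ∉ W' → K i a b = 0) (θ : ℕ)
    (v : Fin n → Bool) (h : θ ≤ (symbolicMatrix K₀ K v).rank) :
    ∃ t : Finset (Fin n), #t ≤ #W + #W' ∧ (∀ i ∈ t, v i = true) ∧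
      θ ≤ (symbolicMatrix K₀ K (fun i => decide (i ∈ t))).rank := by
  rw [le_rank_symbolicMatrix_iff] at h
  obtain ⟨r, c, m, hm, hv⟩ := h
  refine ⟨m.support, ?_, hv, ?_⟩
  · have hne : ((symbolicPolyMatrix K₀ K).submatrix r c).det ≠ 0 := fun h0 => by
      rw [h0, support_zero] at hm
      exact Finset.notMem_empty _ hm
    have hr : Function.Injective r := fun i j hij => by
      by_contra hne'
      exact hne (Matrix.det_zero_of_row_eq hne'
        (funext fun b => by simp [Matrix.submatrix_apply, hij]))
    have hc : Function.Injective c := fun i j hij => by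
      by_contra hne'
      exact hne (Matrix.det_zero_of_column_eq hne' fun a => by simp [Matrix.submatrix_apply, hij])
    calc #m.support ≤ (((symbolicPolyMatrix K₀ K).submatrix r c).det).totalDegree :=
          card_support_le_totalDegree hm
      _ ≤ #(univ.filter fun a => r a ∈ W) + #(univ.filter fun b => c b ∈ W') :=
          totalDegree_det_le_lines _ (fun a => r a ∈ W) (fun b => c b ∈ W')
            (fun a b => totalDegree_symbolicPolyMatrix_apply_le K₀ K (r a) (c b))
            (fun a b ha hb =>
              totalDegree_symbolicPolyMatrix_apply_eq_zero K₀ K fun i => hK i _ _ ha hb)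
      _ ≤ #W + #W' := add_le_add
          (Finset.card_le_card_of_injOn r (fun a ha => (Finset.mem_filter.1 ha).2) hr.injOn)
          (Finset.card_le_card_of_injOn c (fun b hb => (Finset.mem_filter.1 hb).2) hc.injOn)
  · rw [le_rank_symbolicMatrix_iff]
    exact ⟨r, c, m, hm, fun i hi => by simpa using hi⟩

end Lines

/-! ## §2 Wide GRANK gates moving few lines are sandwichable -/

open Classical in
/-- **Wide GRANK gates whose moving part is confined to few lines are sandwichable.** For every
`c` there are `r₀, s₀` such that for `r ≥ r₀`, `s ≥ s₀` and all large `m`: if `φ` accepts `v` iff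
the generic rank of `K₀ + ∑_{vᵢ = 1} Xᵢ Kᵢ` is at least `θ` — matrices of ANY dimension `d` over any
field, ANY threshold `θ`, ANY constant part `K₀` — and every `Kᵢ` vanishes outside a fixed set `W`
of rows and a fixed set `W'` of columns with `#W + #W' ≤ ⌊m^{1/16}⌋₊ (log₂ ⌊m^{1/16}⌋₊ + 1)` (the
support pattern of the moving part has term rank `≤ L`, König), then `φ` fed with `(r-1)`-DNFs
below CNFs satisfies the conclusion of `stub_grankSandwichable`: by `grank_local_lines` every
accepted pattern has an accepted sub-pattern of `≤ #W + #W'` wires, so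
`sandwichable_of_shortPatterns` applies with no exceptional positives. Incomparable with the landed
`grank_smallThreshold_sandwichable` (`θ ≤ L`, moving part arbitrary). [folklore] -/
theorem grank_fewLines_sandwichable : ∀ c : ℕ, ∃ r₀ s₀ : ℕ, 2 ≤ r₀ ∧ 2 ≤ s₀ ∧
    ∀ r s : ℕ, r₀ ≤ r → s₀ ≤ s →
    ∀ᶠ m : ℕ in atTop, ∀ (φ : GateFn) (F : Type) [Field F] (d θ : ℕ)
      (K₀ : Matrix (Fin d) (Fin d) F) (K : Fin φ.1 → Matrix (Fin d) (Fin d) F)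
      (W W' : Finset (Fin d)),
      (∀ v : Fin φ.1 → Bool, φ.2 v = true ↔ θ ≤ (symbolicMatrix K₀ K v).rank) →
      (∀ i a b, a ∉ W → b ∉ W' → K i a b = 0) →
      #W + #W' ≤ ⌊(m : ℝ) ^ (1 / 16 : ℝ)⌋₊ * (Nat.log 2 ⌊(m : ℝ) ^ (1 / 16 : ℝ)⌋₊ + 1) →
      ∀ (D C : Fin φ.1 → Finset (Finset ((⊤ : SimpleGraph (Fin m)).edgeSet))),
        (∀ j, ∀ R ∈ D j, #R ≤ r - 1) → (∀ j x, EvalDNF (D j) x → EvalCNF (C j) x) →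
        ∃ dnf cnf : Finset (Finset ((⊤ : SimpleGraph (Fin m)).edgeSet)),
          (∀ R ∈ dnf, #R ≤ r - 1) ∧ (∀ S ∈ cnf, #S ≤ s - 1) ∧
          (∀ x, EvalDNF dnf x → EvalCNF cnf x) ∧
          (#((posGraphs m ⌈(m : ℝ) ^ (1 / 4 : ℝ)⌉₊).filter
              (fun x => φ.2 (fun j => decide (EvalDNF (D j) x)) = true ∧ ¬ EvalDNF dnf x)) : ℝ)
            ≤ (1 / (8 * (m : ℝ) ^ (c + 1))) * #(posGraphs m ⌈(m : ℝ) ^ (1 / 4 : ℝ)⌉₊) ∧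
          (#((((powersetCard (Fintype.card ((⊤ : SimpleGraph (Fin m)).edgeSet) /
              ⌊(m : ℝ) ^ (1 / 8 : ℝ)⌋₊) (univ : Finset ((⊤ : SimpleGraph (Fin m)).edgeSet))).image
              (fun M => fun e => decide (e ∉ M)))).filter
              (fun x => EvalCNF cnf x ∧ φ.2 (fun j => decide (EvalCNF (C j) x)) = false)) : ℝ)
            ≤ (1 / (8 * (m : ℝ) ^ (c + 1))) *
              #(((powersetCard (Fintype.card ((⊤ : SimpleGraph (Fin m)).edgeSet) /
                ⌊(m : ℝ) ^ (1 / 8 : ℝ)⌋₊) (univ : Finset ((⊤ : SimpleGraph (Fin m)).edgeSet))).image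
                (fun M => fun e => decide (e ∉ M)))) := by
  intro c
  obtain ⟨r₀, s₀, hr₀, hs₀, H⟩ := sandwichable_of_shortPatterns c
  refine ⟨r₀, s₀, hr₀, hs₀, fun r s hr hs => ?_⟩
  filter_upwards [H r s hr hs] with m hm
  intro φ F _ d θ K₀ K W W' hφ hK hW D C hDw hDC
  have hG : IsGRankGate d φ := ⟨F, inferInstance, d, θ, le_rfl, K₀, K, hφ⟩
  refine hm φ hG.monotone D C hDw hDC fun E hE hbad => ?_
  -- no exceptional positives: every accepted pattern has an accepted sub-pattern of `≤ #W + #W'` wires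
  suffices hE0 : E = ∅ by rw [hE0, Finset.card_empty, Nat.zero_mul]; exact Nat.zero_le _
  refine Finset.eq_empty_of_forall_notMem fun x hx => ?_
  obtain ⟨hacc, hno⟩ := hbad x hx
  obtain ⟨t, ht, hton, htacc⟩ := grank_local_lines K₀ K W W' hK θ _ ((hφ _).1 hacc)
  have h1 := hno t (ht.trans hW) (fun i hi => of_decide_eq_true (hton i hi))
  rw [(hφ _).2 htacc] at h1
  exact Bool.noConfusion h1

end Summit.PneNP.PneNP.Theorems.CliqueExtLowerBound.WidthThreshold.GRankPartial
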